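import Mathlib
import Summits.ValiantsHypothesis.ValiantsHypothesis.Theorems.NewtonUnitEquationsTwoProductsFormalLogLinearisationDefs
import Summits.ValiantsHypothesis.ValiantsHypothesis.Theorems.NewtonUnitEquationsTwoProductsFormalLogLinearisationSectorTops
import Literature.Computability.AlgebraicComplexity.NewtonPolygonTau
import Literature.Computability.AlgebraicComplexity.NewtonPolygonTauProductBounds
import HarnessLib

/-!
# Route NewtonUnitEquations — crux `TwoProducts` (stmt-ValiantsHypothesis-5906), line `formal-log-linearisation`:
# stub 1 `stub_sectorDecomposition` (the sector decomposition of the vertex count)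

Registered line `Cruxes/TwoProducts/Lines/formal-log-linearisation.lean` (NOT the item's skeleton of record;
helper mode, no stub credit claimed). Objects `Expo` / `wt` / `IsStrictTop` / `Cancelling` / `hidden` = the
line's vocabulary, verbatim, in the companion `Theorems/NewtonUnitEquationsTwoProductsFormalLogLinearisationDefs.lean`
(one Defs file for the whole line); the sector TOOLBOX (top-assignments, Ostrowski tops of products, the assignment
count, the two fibre lemmas) is the companion `Theorems/NewtonUnitEquationsTwoProductsFormalLogLinearisationSectorTops.lean`.
This file proves STUB 1 of the line, VERBATIM:

* `stub_sectorDecomposition` — if every factor `f j`, `g j` (`j < m`) has at most `t` monomials and every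
  CANCELLING top-assignment `(a, b)` has at most `B` hidden vertices, then
  `#vert Newt(∏ f − ∏ g) ≤ 4mt + 2 + 2mt·B`.

Proof (the line card's sector decomposition, organised WITHOUT angles or arcs). Put `h = ∏ f − ∏ g`.
If some factor vanishes, `h` is `0` or `±` a single product and the tree's product bound
`newtonVertexCount_prod_le_mul` (`≤ mt`) suffices. Otherwise every vertex `x` of `Newt(h)` is the strict top
of `supp h` for a weight `w` that is GENERIC on all `2m` factor supports (the tree's
`KPTT.PlanarMinkowski.exists_chart_injOn`), so `w` selects a top-assignment `(a, b)` (one exponent per factor).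
(i) Distinct realised top-assignments have distinct sums `Σ a_j + Σ b_j`, which are strict tops — hence hull
vertices — of the Minkowski sum `Σ_j supp f_j + Σ_j supp g_j`; by the tree's planar Minkowski vertex bound
`ncard_extremePoints_sum_le_sum_card` there are at most `Σ_j |supp f_j| + |supp g_j| ≤ 2mt` of them.
(ii) For a fixed assignment: the top monomials of the two products are `A = Σ a_j`, `B' = Σ b_j` with the
coefficients `∏ coeff`, by Ostrowski's non-cancellation (`isStrictTop_prod`); if `(a, b)` is NOT cancelling the
exposed vertex is `A` or `B'` (`eq_or_eq_of_not_cancelling`, `≤ 2` vertices), and if it IS cancelling the vertex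
is a hidden vertex of `(a, b)` by definition (`≤ B`). Hence `V ≤ 2mt · max(2, B) ≤ 4mt + 2 + 2mt·B`.

Honest framing: stub 1 is planar convex-geometry bookkeeping of the line; the line's engine `stub_logSumEngine`
stays OPEN, the crux `TwoProducts` stays OPEN, the line is not the item's skeleton of record, and nothing here is
progress on `VP ≠ VNP` (NOT proved). No definitions, no named facts.
-/

noncomputable section

-- Sub = Summit single-conjunct layout: the duplicated namespace component is mandated by the tree.
set_option linter.dupNamespace false

namespace Summit.ValiantsHypothesis.ValiantsHypothesis.Theorems.NewtonUnitEquations.TwoProducts.FormalLogLinearisation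

open MvPolynomial Literature.Computability.AlgebraicComplexity
open scoped BigOperators Pointwise

/-! ### The degenerate case: a vanishing factor -/

/-- Negation does not change the Newton polygon. [folklore] -/
theorem newtonVertexCount_neg (p : MvPolynomial (Fin 2) ℂ) : newtonVertexCount (-p) = newtonVertexCount p := by
  unfold newtonVertexCount
  rw [MvPolynomial.support_neg]

/-- If some factor `f j` or `g j` vanishes, `∏ f − ∏ g` is `0` or `±` one product, so its Newton polygon has at
most `m t` vertices (the tree's `newtonVertexCount_prod_le_mul`). [folklore] -/
theorem newtonVertexCount_sub_le_of_zero_factor {m t : ℕ} (f g : Fin m → MvPolynomial (Fin 2) ℂ)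
    (hf : ∀ j, (f j).support.card ≤ t) (hg : ∀ j, (g j).support.card ≤ t)
    (h0 : (∃ j, f j = 0) ∨ ∃ j, g j = 0) :
    newtonVertexCount (∏ j, f j - ∏ j, g j) ≤ m * t := by
  classical
  have hm : m ≠ 0 := by
    rcases h0 with ⟨j, _⟩ | ⟨j, _⟩ <;> exact Nat.pos_iff_ne_zero.1 (Fin.pos j)
  by_cases hF : ∃ j, f j = 0
  · obtain ⟨j, hj⟩ := hF
    have hPf : ∏ j, f j = 0 := Finset.prod_eq_zero (Finset.mem_univ j) hj
    rw [hPf, zero_sub, newtonVertexCount_neg]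
    exact newtonVertexCount_prod_le_mul hm g hg
  · have hG : ∃ j, g j = 0 := h0.resolve_left hF
    obtain ⟨j, hj⟩ := hG
    have hPg : ∏ j, g j = 0 := Finset.prod_eq_zero (Finset.mem_univ j) hj
    rw [hPg, sub_zero]
    exact newtonVertexCount_prod_le_mul hm f hf

/-! ### The stub -/

/-- **STUB 1 of the line `formal-log-linearisation` (`SectorDecomposition`), verbatim.** If every factor has at
most `t` monomials and every cancelling top-assignment has at most `B` hidden vertices, then
`#vert Newt(∏ f − ∏ g) ≤ 4mt + 2 + 2mt·B` (in fact `≤ 2mt · max(2, B)`): every hull vertex is exposed by a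
weight generic on all factor supports; the realised top-assignments number at most
`#vert conv(Σ supp f_j + Σ supp g_j) ≤ 2mt`; a non-cancelling assignment exposes only its two product tops and a
cancelling one only its hidden vertices. Helper for crux `TwoProducts` (stmt-ValiantsHypothesis-5906) on a
registered non-record line; the crux stays OPEN. [folklore] -/
theorem stub_sectorDecomposition :
    ∀ (m t : ℕ) (f g : Fin m → MvPolynomial (Fin 2) ℂ), (∀ j, (f j).support.card ≤ t) →
      (∀ j, (g j).support.card ≤ t) →
        ∀ B : ℕ, (∀ a b : Fin m → Expo, Cancelling f g a b → (hidden f g a b).ncard ≤ B) →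
          newtonVertexCount (∏ j, f j - ∏ j, g j) ≤ 4 * m * t + 2 + 2 * m * t * B := by
  classical
  intro m t f g hf hg B hB
  -- a vanishing factor: one product
  by_cases h0 : (∃ j, f j = 0) ∨ ∃ j, g j = 0
  · refine (newtonVertexCount_sub_le_of_zero_factor f g hf hg h0).trans ?_
    nlinarith [Nat.zero_le (m * t), Nat.zero_le (m * t * B)]
  push Not at h0
  obtain ⟨hf0, hg0⟩ := h0
  -- no factors at all: `h = 1 - 1 = 0`
  rcases Nat.eq_zero_or_pos m with hm | hm
  · subst hm
    have : (∏ j : Fin 0, f j - ∏ j : Fin 0, g j) = 0 := by simp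
    rw [this, newtonVertexCount_zero]
    exact Nat.zero_le _
  haveI : Nonempty (Fin m) := ⟨⟨0, hm⟩⟩
  -- notation
  set emb : Expo → (Fin 2 → ℝ) := fun e i => ((e i : ℕ) : ℝ) with hemb
  set h : MvPolynomial (Fin 2) ℂ := ∏ j, f j - ∏ j, g j with hh
  set F : Finset (Fin 2 → ℝ) := h.support.image emb with hFdef
  set Sf : Fin m → Finset (Fin 2 → ℝ) := fun j => (f j).support.image emb with hSf
  set Sg : Fin m → Finset (Fin 2 → ℝ) := fun j => (g j).support.image emb with hSg
  have hSfne : ∀ j, (Sf j).Nonempty := fun j => (MvPolynomial.support_nonempty.2 (hf0 j)).image _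
  have hSgne : ∀ j, (Sg j).Nonempty := fun j => (MvPolynomial.support_nonempty.2 (hg0 j)).image _
  set E : Set (Fin 2 → ℝ) := (convexHull ℝ (F : Set (Fin 2 → ℝ))).extremePoints ℝ with hEdef
  have hVE : newtonVertexCount h = E.ncard := by
    unfold newtonVertexCount
    rw [hEdef, hFdef, Finset.coe_image]
  have hEF : E ⊆ ↑F := extremePoints_convexHull_subset
  set Ef : Finset (Fin 2 → ℝ) := F.filter fun x => x ∈ E with hEfdef
  have hEfE : ∀ x, x ∈ Ef ↔ x ∈ E := by
    intro x
    rw [hEfdef, Finset.mem_filter]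
    exact ⟨fun hx => hx.2, fun hx => ⟨hEF hx, hx⟩⟩
  have hcoe : (↑Ef : Set (Fin 2 → ℝ)) = E := by
    ext x; exact hEfE x
  have hVcard : E.ncard = Ef.card := by rw [← hcoe, Set.ncard_coe_finset]
  -- every vertex is exposed by a weight generic on all factor supports: a top-assignment
  have key : ∀ x ∈ Ef, ∃ w : Fin 2 → ℝ, ∃ a b : Fin m → Expo,
      KPTT.PlanarMinkowski.IsStrictTop w F x ∧
        (∀ j, KPTT.PlanarMinkowski.IsStrictTop w (Sf j) (emb (a j))) ∧
        ∀ j, KPTT.PlanarMinkowski.IsStrictTop w (Sg j) (emb (b j)) := by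
    intro x hx
    have hxE : x ∈ E := (hEfE x).1 hx
    obtain ⟨σ, s, -, htop, hinj⟩ := KPTT.PlanarMinkowski.exists_chart_injOn
      (Finset.univ : Finset (Fin m)) (fun j => Sf j ∪ Sg j) hxE
    have ha : ∀ j, ∃ a : Expo, KPTT.PlanarMinkowski.IsStrictTop ![σ, s] (Sf j) (emb a) := by
      intro j
      have hinj' : Set.InjOn (fun y => ![σ, s] ⬝ᵥ y) (Sf j : Set (Fin 2 → ℝ)) :=
        (hinj j (Finset.mem_univ j)).mono (Finset.coe_subset.2 Finset.subset_union_left)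
      obtain ⟨y, hy⟩ := KPTT.PlanarMinkowski.exists_isStrictTop_of_injOn (hSfne j) hinj'
      obtain ⟨a, -, rfl⟩ := Finset.mem_image.1 hy.1
      exact ⟨a, hy⟩
    have hb : ∀ j, ∃ b : Expo, KPTT.PlanarMinkowski.IsStrictTop ![σ, s] (Sg j) (emb b) := by
      intro j
      have hinj' : Set.InjOn (fun y => ![σ, s] ⬝ᵥ y) (Sg j : Set (Fin 2 → ℝ)) :=
        (hinj j (Finset.mem_univ j)).mono (Finset.coe_subset.2 Finset.subset_union_right)
      obtain ⟨y, hy⟩ := KPTT.PlanarMinkowski.exists_isStrictTop_of_injOn (hSgne j) hinj'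
      obtain ⟨b, -, rfl⟩ := Finset.mem_image.1 hy.1
      exact ⟨b, hy⟩
    choose a ha' using ha
    choose b hb' using hb
    exact ⟨![σ, s], a, b, htop, ha', hb'⟩
  choose! W Aa Bb hW hA hBb using key
  -- the assignment map and its image
  let τ : (Fin 2 → ℝ) → (Fin m → Expo) × (Fin m → Expo) := fun x => (Aa x, Bb x)
  set T := Ef.image τ with hTdef
  -- (i) the assignment count: `#T ≤ 2mt`
  have hTcard : T.card ≤ 2 * m * t := by
    -- embed pairs as tuples over `Fin m ⊕ Fin m`
    let S : Fin m ⊕ Fin m → Finset (Fin 2 → ℝ) := Sum.elim Sf Sg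
    let ι' : (Fin m → Expo) × (Fin m → Expo) → (Fin m ⊕ Fin m → (Fin 2 → ℝ)) :=
      fun p => Sum.elim (fun j => emb (p.1 j)) (fun j => emb (p.2 j))
    have hι' : Function.Injective ι' := by
      intro p p' hpp
      have h1 : p.1 = p'.1 := by
        funext j
        exact natEmb_injective (by simpa [ι'] using congr_fun hpp (Sum.inl j))
      have h2 : p.2 = p'.2 := by
        funext j
        exact natEmb_injective (by simpa [ι'] using congr_fun hpp (Sum.inr j))
      exact Prod.ext h1 h2
    have hS : ∀ i, (S i).Nonempty := by
      rintro (j | j)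
      · exact hSfne j
      · exact hSgne j
    have hT' : ∀ τ' ∈ T.image ι', ∃ w : Fin 2 → ℝ, ∀ i, KPTT.PlanarMinkowski.IsStrictTop w (S i) (τ' i) := by
      intro τ' hτ'
      obtain ⟨p, hp, rfl⟩ := Finset.mem_image.1 hτ'
      obtain ⟨x, hx, rfl⟩ := Finset.mem_image.1 hp
      refine ⟨W x, ?_⟩
      rintro (j | j)
      · exact hA x hx j
      · exact hBb x hx j
    have h1 := card_topTuples_le_sum_card S hS (T.image ι') hT'
    rw [Finset.card_image_of_injective _ hι', Fintype.sum_sum_type] at h1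
    refine h1.trans ?_
    have ef : ∑ j, (S (Sum.inl j)).card ≤ m * t := by
      calc ∑ j, (S (Sum.inl j)).card ≤ ∑ _j : Fin m, t :=
            Finset.sum_le_sum fun j _ => Finset.card_image_le.trans (hf j)
        _ = m * t := by simp
    have eg : ∑ j, (S (Sum.inr j)).card ≤ m * t := by
      calc ∑ j, (S (Sum.inr j)).card ≤ ∑ _j : Fin m, t :=
            Finset.sum_le_sum fun j _ => Finset.card_image_le.trans (hg j)
        _ = m * t := by simp
    linarith
  -- (ii) the fibres: `≤ max 2 B` vertices per assignment
  have hfib : ∀ p ∈ T, (Ef.filter fun x => τ x = p).card ≤ max 2 B := by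
    rintro ⟨a, b⟩ hp
    -- every vertex of the fibre is `emb l`, `l` the strict `W x`-top of `supp h`, with assignment `(a, b)`
    have hmem : ∀ x ∈ Ef.filter (fun x => τ x = (a, b)), ∃ l : Expo, x = emb l ∧
        (∀ j, KPTT.PlanarMinkowski.IsStrictTop (W x) (Sf j) (emb (a j))) ∧
        (∀ j, KPTT.PlanarMinkowski.IsStrictTop (W x) (Sg j) (emb (b j))) ∧
        KPTT.PlanarMinkowski.IsStrictTop (W x) F (emb l) := by
      intro x hx
      obtain ⟨hxEf, hτx⟩ := Finset.mem_filter.1 hx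
      have hax : Aa x = a := congr_arg Prod.fst hτx
      have hbx : Bb x = b := congr_arg Prod.snd hτx
      obtain ⟨l, -, rfl⟩ := Finset.mem_image.1 (hW x hxEf).1
      refine ⟨l, rfl, fun j => ?_, fun j => ?_, hW _ hxEf⟩
      · rw [← hax]; exact hA _ hxEf j
      · rw [← hbx]; exact hBb _ hxEf j
    by_cases hc : Cancelling f g a b
    · -- cancelling: the fibre lies in the hidden set
      refine le_trans ?_ ((hB a b hc).trans (le_max_right 2 B))
      have hsub : (↑(Ef.filter fun x => τ x = (a, b)) : Set (Fin 2 → ℝ)) ⊆ emb '' hidden f g a b := by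
        intro x hx
        obtain ⟨l, rfl, ha, hb, hl⟩ := hmem x (Finset.mem_coe.1 hx)
        exact ⟨l, mem_hidden_of_tops ha hb hl, rfl⟩
      rw [← Set.ncard_coe_finset]
      exact (Set.ncard_le_ncard hsub ((hidden_finite' f g a b).image emb)).trans
        (Set.ncard_image_le (hidden_finite' f g a b))
    · -- non-cancelling: the fibre lies in the two product tops
      refine le_trans ?_ (le_max_left 2 B)
      have hsub : (Ef.filter fun x => τ x = (a, b)) ⊆ {emb (∑ j, a j), emb (∑ j, b j)} := by
        intro x hx
        obtain ⟨l, rfl, ha, hb, hl⟩ := hmem x hx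
        rcases eq_or_eq_of_not_cancelling ha hb hl hc with h | h
        · rw [h]; exact Finset.mem_insert_self _ _
        · rw [h]; exact Finset.mem_insert_of_mem (Finset.mem_singleton_self _)
      exact (Finset.card_le_card hsub).trans (Finset.card_le_two)
  -- assembly
  have hsum : Ef.card = ∑ p ∈ T, (Ef.filter fun x => τ x = p).card := Finset.card_eq_sum_card_image τ Ef
  have hEf : Ef.card ≤ T.card * max 2 B := by
    rw [hsum]
    refine (Finset.sum_le_sum hfib).trans ?_
    rw [Finset.sum_const, smul_eq_mul]
  rw [hVE, hVcard]
  have hmax : max 2 B ≤ 2 + B := max_le (by omega) (by omega)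
  have h1 : T.card * max 2 B ≤ 2 * m * t * (2 + B) :=
    Nat.mul_le_mul hTcard hmax
  have h2 : 2 * m * t * (2 + B) = 4 * m * t + 2 * m * t * B := by ring
  omega

/-! ### The sector decomposition with an explicit assignment count (for structured families) -/

/-- **Sector decomposition, parametrised by the assignment count.** If no factor vanishes, every finite set of
REALISED top-assignments (tuples of simultaneous strict tops of all `2m` supports for one weight) has at most `N`
elements, and every cancelling top-assignment has at most `B` hidden vertices, then
`#vert Newt(∏ f − ∏ g) ≤ N · max(2, B)`. (`stub_sectorDecomposition` is the case `N = 2mt` supplied by the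
Minkowski-sum vertex bound; structured families — e.g. all supports translates of one shape — have far fewer
realised assignments.) Same proof as the stub: generic exposing weights, fibres `≤ 2` (non-cancelling) or `≤ B`
(cancelling). [folklore] -/
theorem newtonVertexCount_le_of_assignmentCount {m : ℕ} (f g : Fin m → MvPolynomial (Fin 2) ℂ)
    (hf0 : ∀ j, f j ≠ 0) (hg0 : ∀ j, g j ≠ 0) (N B : ℕ)
    (hN : ∀ T : Finset ((Fin m → Expo) × (Fin m → Expo)),
      (∀ p ∈ T, ∃ ξ : Fin 2 → ℝ, (∀ j, IsStrictTop ξ ↑(f j).support (p.1 j)) ∧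
        (∀ j, IsStrictTop ξ ↑(g j).support (p.2 j))) → T.card ≤ N)
    (hB : ∀ a b : Fin m → Expo, Cancelling f g a b → (hidden f g a b).ncard ≤ B) :
    newtonVertexCount (∏ j, f j - ∏ j, g j) ≤ N * max 2 B := by
  classical
  -- notation
  set emb : Expo → (Fin 2 → ℝ) := fun e i => ((e i : ℕ) : ℝ) with hemb
  set h : MvPolynomial (Fin 2) ℂ := ∏ j, f j - ∏ j, g j with hh
  set F : Finset (Fin 2 → ℝ) := h.support.image emb with hFdef
  set Sf : Fin m → Finset (Fin 2 → ℝ) := fun j => (f j).support.image emb with hSf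
  set Sg : Fin m → Finset (Fin 2 → ℝ) := fun j => (g j).support.image emb with hSg
  have hSfne : ∀ j, (Sf j).Nonempty := fun j => (MvPolynomial.support_nonempty.2 (hf0 j)).image _
  have hSgne : ∀ j, (Sg j).Nonempty := fun j => (MvPolynomial.support_nonempty.2 (hg0 j)).image _
  set E : Set (Fin 2 → ℝ) := (convexHull ℝ (F : Set (Fin 2 → ℝ))).extremePoints ℝ with hEdef
  have hVE : newtonVertexCount h = E.ncard := by
    unfold newtonVertexCount
    rw [hEdef, hFdef, Finset.coe_image]
  have hEF : E ⊆ ↑F := extremePoints_convexHull_subset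
  set Ef : Finset (Fin 2 → ℝ) := F.filter fun x => x ∈ E with hEfdef
  have hEfE : ∀ x, x ∈ Ef ↔ x ∈ E := by
    intro x
    rw [hEfdef, Finset.mem_filter]
    exact ⟨fun hx => hx.2, fun hx => ⟨hEF hx, hx⟩⟩
  have hcoe : (↑Ef : Set (Fin 2 → ℝ)) = E := by
    ext x; exact hEfE x
  have hVcard : E.ncard = Ef.card := by rw [← hcoe, Set.ncard_coe_finset]
  -- every vertex is exposed by a weight generic on all factor supports: a top-assignment
  have key : ∀ x ∈ Ef, ∃ w : Fin 2 → ℝ, ∃ a b : Fin m → Expo,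
      KPTT.PlanarMinkowski.IsStrictTop w F x ∧
        (∀ j, KPTT.PlanarMinkowski.IsStrictTop w (Sf j) (emb (a j))) ∧
        ∀ j, KPTT.PlanarMinkowski.IsStrictTop w (Sg j) (emb (b j)) := by
    intro x hx
    have hxE : x ∈ E := (hEfE x).1 hx
    obtain ⟨σ, s, -, htop, hinj⟩ := KPTT.PlanarMinkowski.exists_chart_injOn
      (Finset.univ : Finset (Fin m)) (fun j => Sf j ∪ Sg j) hxE
    have ha : ∀ j, ∃ a : Expo, KPTT.PlanarMinkowski.IsStrictTop ![σ, s] (Sf j) (emb a) := by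
      intro j
      have hinj' : Set.InjOn (fun y => ![σ, s] ⬝ᵥ y) (Sf j : Set (Fin 2 → ℝ)) :=
        (hinj j (Finset.mem_univ j)).mono (Finset.coe_subset.2 Finset.subset_union_left)
      obtain ⟨y, hy⟩ := KPTT.PlanarMinkowski.exists_isStrictTop_of_injOn (hSfne j) hinj'
      obtain ⟨a, -, rfl⟩ := Finset.mem_image.1 hy.1
      exact ⟨a, hy⟩
    have hb : ∀ j, ∃ b : Expo, KPTT.PlanarMinkowski.IsStrictTop ![σ, s] (Sg j) (emb b) := by
      intro j
      have hinj' : Set.InjOn (fun y => ![σ, s] ⬝ᵥ y) (Sg j : Set (Fin 2 → ℝ)) :=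
        (hinj j (Finset.mem_univ j)).mono (Finset.coe_subset.2 Finset.subset_union_right)
      obtain ⟨y, hy⟩ := KPTT.PlanarMinkowski.exists_isStrictTop_of_injOn (hSgne j) hinj'
      obtain ⟨b, -, rfl⟩ := Finset.mem_image.1 hy.1
      exact ⟨b, hy⟩
    choose a ha' using ha
    choose b hb' using hb
    exact ⟨![σ, s], a, b, htop, ha', hb'⟩
  choose! W Aa Bb hW hA hBb using key
  -- the assignment map and its image
  let τ : (Fin 2 → ℝ) → (Fin m → Expo) × (Fin m → Expo) := fun x => (Aa x, Bb x)
  set T := Ef.image τ with hTdef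
  -- (i) the assignment count, supplied by the hypothesis
  have hTcard : T.card ≤ N := by
    refine hN T fun p hp => ?_
    obtain ⟨x, hx, rfl⟩ := Finset.mem_image.1 hp
    exact ⟨W x, fun j => (isStrictTop_iff_planar _ _ _).2 (hA x hx j),
      fun j => (isStrictTop_iff_planar _ _ _).2 (hBb x hx j)⟩
  -- (ii) the fibres: `≤ max 2 B` vertices per assignment
  have hfib : ∀ p ∈ T, (Ef.filter fun x => τ x = p).card ≤ max 2 B := by
    rintro ⟨a, b⟩ hp
    have hmem : ∀ x ∈ Ef.filter (fun x => τ x = (a, b)), ∃ l : Expo, x = emb l ∧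
        (∀ j, KPTT.PlanarMinkowski.IsStrictTop (W x) (Sf j) (emb (a j))) ∧
        (∀ j, KPTT.PlanarMinkowski.IsStrictTop (W x) (Sg j) (emb (b j))) ∧
        KPTT.PlanarMinkowski.IsStrictTop (W x) F (emb l) := by
      intro x hx
      obtain ⟨hxEf, hτx⟩ := Finset.mem_filter.1 hx
      have hax : Aa x = a := congr_arg Prod.fst hτx
      have hbx : Bb x = b := congr_arg Prod.snd hτx
      obtain ⟨l, -, rfl⟩ := Finset.mem_image.1 (hW x hxEf).1
      refine ⟨l, rfl, fun j => ?_, fun j => ?_, hW _ hxEf⟩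
      · rw [← hax]; exact hA _ hxEf j
      · rw [← hbx]; exact hBb _ hxEf j
    by_cases hc : Cancelling f g a b
    · refine le_trans ?_ ((hB a b hc).trans (le_max_right 2 B))
      have hsub : (↑(Ef.filter fun x => τ x = (a, b)) : Set (Fin 2 → ℝ)) ⊆ emb '' hidden f g a b := by
        intro x hx
        obtain ⟨l, rfl, ha, hb, hl⟩ := hmem x (Finset.mem_coe.1 hx)
        exact ⟨l, mem_hidden_of_tops ha hb hl, rfl⟩
      rw [← Set.ncard_coe_finset]
      exact (Set.ncard_le_ncard hsub ((hidden_finite' f g a b).image emb)).trans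
        (Set.ncard_image_le (hidden_finite' f g a b))
    · refine le_trans ?_ (le_max_left 2 B)
      have hsub : (Ef.filter fun x => τ x = (a, b)) ⊆ {emb (∑ j, a j), emb (∑ j, b j)} := by
        intro x hx
        obtain ⟨l, rfl, ha, hb, hl⟩ := hmem x hx
        rcases eq_or_eq_of_not_cancelling ha hb hl hc with h | h
        · rw [h]; exact Finset.mem_insert_self _ _
        · rw [h]; exact Finset.mem_insert_of_mem (Finset.mem_singleton_self _)
      exact (Finset.card_le_card hsub).trans (Finset.card_le_two)
  -- assembly
  have hsum : Ef.card = ∑ p ∈ T, (Ef.filter fun x => τ x = p).card := Finset.card_eq_sum_card_image τ Ef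
  have hEf : Ef.card ≤ T.card * max 2 B := by
    rw [hsum]
    refine (Finset.sum_le_sum hfib).trans ?_
    rw [Finset.sum_const, smul_eq_mul]
  rw [hVE, hVcard]
  exact hEf.trans (Nat.mul_le_mul_right _ hTcard)

end Summit.ValiantsHypothesis.ValiantsHypothesis.Theorems.NewtonUnitEquations.TwoProducts.FormalLogLinearisation

end
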